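import Summits.CriticalPhenomena.CardyFormulaZ2.Theses.CardySelfDualSegment
import Summits.CriticalPhenomena.CardyFormulaZ2.Theorems.CardyIKTransportAnchorByRigidity
import Summits.CriticalPhenomena.CardyFormulaZ2.Theorems.CardySelfDualSegmentQuarterTurnPinningStubBondCrudeQuarterTurn
import Literature.Probability.Percolation.CornerPercolation
import Literature.Probability.Percolation.CardyFormulaConformalInvariance
import Literature.Barriers.CriticalPhenomena.EmbeddingModulusUniquenessProofs

/-!
# `QuarterTurnPinning` (stmt-CriticalPhenomena-5475) — endpoint pinning of the self-dual segment

Route `CardySelfDualSegment` of `CriticalPhenomena/CardyFormulaZ2`, crux `QuarterTurnPinning`,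
proved (`quarterTurnPinning_proof`): if `CardyMod 1 α` holds for some `α` in the upper half-plane
(the crude crossing probabilities of the corner model `M_1` converge, in every conformal
rectangle `R'`, to Cardy's value of the sheared rectangle `φ_α R'`, `φ_α = moduliShear α`), then
Bernoulli bond percolation on `ℤ²` at `p = 1/2` satisfies Cardy's formula for the crude event
`embDomainCrossing squareLatticeEmbedding.z` in every conformal rectangle.

Proof (line `CardySelfDualSegmentQuarterTurnPinning`, card `phantom-triangular-anchor`).

* `hasCrossingLimit_of_quarterTurn_of_shearCardy` — the transfer: for ANY family `P` of crossing
  functions with quarter-turn invariant limits and any non-real `α` such that `P R'` tends to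
  Cardy's value of `φ_α R'`, `P` has Cardy limits in every conformal rectangle. This is the
  tree's proved `anchorByRigidity_proof` (item stmt-CriticalPhenomena-4969 of route
  `CardyIKTransport`) with `K := φ_α` packaged as a real-linear automorphism of `ℂ` and Smirnov's
  proved theorem `hasCrossingLimit_triDomainCrossingProb_holds` as a phantom comparison model:
  its hypothesis (b) ("`P R` has the same limits as site-`𝕋` on `φ_α R`") holds because both
  families converge to the same Cardy value and limits along `𝓝[>] 0` are unique. The rigidity
  (`E = K ∘ (i·) ∘ K⁻¹` preserves every modulus, hence is a similarity, `E² = -1`, `K` complex- or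
  conjugate-linear, moduli preserved) is consumed inside that black box.
* the finite-`δ` quarter-turn identity `stub_bondCrude_quarterTurn` (file
  `CardySelfDualSegmentQuarterTurnPinningStubBondCrudeQuarterTurn.lean`) supplies hypothesis (a);
* `quarterTurnPinning_proof` — the route's inlined `let`-blocks are `cornerParam` /
  `cornerConfig` / `cornerCrossingProb` verbatim, and `cornerCrossingProb_eq` +
  `cornerPercolation_one` (`M_1 = P_{1/2}` bond-`ℤ²`) turn `P 1 R'` into the crude bond crossing
  probability.

References: V. Beffara, *Is critical 2D percolation universal?* (2008), §2.2 (the order-4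
symmetry of `ℤ²` pins the modulus `α = i`); S. Smirnov, C. R. Acad. Sci. Paris 333 (2001);
R. Langlands, P. Pouliot, Y. Saint-Aubin, Bull. AMS 30 (1994), §2.4.
-/

noncomputable section

open Set Filter Topology Complex MeasureTheory
open UpperHalfPlane (upperHalfPlaneSet)
open Literature.Probability.RandomPlanarGeometry
open Literature.Probability.Percolation hiding cardyFunction
open Literature.Probability.LatticeModels
open Literature.Barriers.CriticalPhenomena

namespace Summit.CriticalPhenomena.CardyFormulaZ2.Theorems

/-- **Transfer** (`C⁺` of the line): a family `P` of crossing functions of conformal rectangles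
with quarter-turn invariant `δ → 0⁺` limits, whose values on `R'` tend to Cardy's value of the
sheared rectangle `φ_α R'` for one non-real `α`, has Cardy limits in every conformal rectangle.
Proof: `anchorByRigidity_proof` (item 4969, proved) with `K := φ_α` as a continuous real-linear
automorphism of `ℂ` and Smirnov's theorem (`hasCrossingLimit_triDomainCrossingProb_holds`) as the
comparison model; hypothesis (b) of that theorem holds because `P R` and the site-`𝕋` crossing
probability of `R.map K` both tend to `cardyFunction (crossRatio x)` for a uniformizing datum
`(φ, x)` of `R.map K` (`MarkedDomain.exists_isUniformizing_holds`), and limits are unique. -/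
theorem hasCrossingLimit_of_quarterTurn_of_shearCardy (P : ConformalRectangle → ℝ → ℝ)
    (hqt : ∀ (R : ConformalRectangle) (L : ℝ),
      Tendsto (P (R.map (Homeomorph.mulLeft₀ I I_ne_zero))) (𝓝[>] 0) (𝓝 L) ↔
        Tendsto (P R) (𝓝[>] 0) (𝓝 L))
    {α : ℂ} (hα : α.im ≠ 0)
    (hC : ∀ (R R' : ConformalRectangle) (φ : ConformalEquiv upperHalfPlaneSet R.carrier)
      (x : Fin 4 → ℝ), R.carrier = moduliShear α '' R'.carrier →
      (∀ i, R.pt i = moduliShear α (R'.pt i)) → R.IsUniformizing φ x →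
      Tendsto (P R') (𝓝[>] 0) (𝓝 (cardyFunction (crossRatio x)))) :
    ∀ R : ConformalRectangle, R.HasCrossingLimit (P R) cardyFunction := by
  -- `K := φ_α` as a continuous real-linear automorphism of `ℂ` (inverse `φ_{(i - re α)/im α}`)
  obtain ⟨K, hK⟩ : ∃ K : ℂ ≃L[ℝ] ℂ, ⇑K.toHomeomorph = moduliShear α :=
    ⟨{ toFun := moduliShear α
       invFun := (shearHomeomorph α hα).symm
       map_add' := fun z w => by
         simp only [moduliShear, add_re, add_im, ofReal_add]; ring
       map_smul' := fun r z => by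
         simp only [moduliShear, RingHom.id_apply, Complex.real_smul, re_ofReal_mul,
           im_ofReal_mul, ofReal_mul]; ring
       left_inv := (shearHomeomorph α hα).left_inv
       right_inv := (shearHomeomorph α hα).right_inv
       continuous_toFun := continuous_moduliShear α
       continuous_invFun := (shearHomeomorph α hα).symm.continuous }, rfl⟩
  refine (anchorByRigidity_proof hasCrossingLimit_triDomainCrossingProb_holds P K hqt ?_).2
  -- hypothesis (b): `P R` and site-`𝕋` on `R.map K` have the same limits (both are Cardy's value)
  intro R L
  obtain ⟨φ, x, hφ⟩ := MarkedDomain.exists_isUniformizing_holds (R.map K.toHomeomorph)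
  have t1 : Tendsto (P R) (𝓝[>] 0) (𝓝 (cardyFunction (crossRatio x))) :=
    hC (R.map K.toHomeomorph) R φ x (by rw [MarkedDomain.carrier_map, hK])
      (fun i => by rw [MarkedDomain.pt_map, hK]) hφ
  have t2 : Tendsto (triDomainCrossingProb (R.map K.toHomeomorph)) (𝓝[>] 0)
      (𝓝 (cardyFunction (crossRatio x))) :=
    hasCrossingLimit_triDomainCrossingProb_holds (R.map K.toHomeomorph) φ x hφ
  constructor
  · intro h
    rw [tendsto_nhds_unique h t1]
    exact t2
  · intro h
    rw [tendsto_nhds_unique h t2]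
    exact t1

/-- **`QuarterTurnPinning` — PROVED** (item stmt-CriticalPhenomena-5475 of route
`CardySelfDualSegment`): if `CardyMod 1 α` holds for some `α` with `0 < im α`, then bond
percolation on `ℤ²` at `1/2` satisfies Cardy's formula in the crude discretisation
(`embDomainCrossing squareLatticeEmbedding.z`) in every conformal rectangle. The route's inlined
`let`-blocks are definitionally `cornerParam` / `cornerConfig` / `cornerCrossingProb`; at `t = 1`
the corner model is Bernoulli bond percolation at `1/2` (`cornerPercolation_one`), so `P 1 R'` is
the crude bond crossing probability (`cornerCrossingProb_eq`), to which
`hasCrossingLimit_of_quarterTurn_of_shearCardy` applies with the finite quarter-turn identity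
`stub_bondCrude_quarterTurn`. -/
theorem quarterTurnPinning_proof :
    Summit.CriticalPhenomena.CardyFormulaZ2.Theses.CardySelfDualSegment.QuarterTurnPinning := by
  unfold Summit.CriticalPhenomena.CardyFormulaZ2.Theses.CardySelfDualSegment.QuarterTurnPinning
  intro prm cfg P CardyMod hex
  obtain ⟨α, hα, hCM⟩ := hex
  -- `P 1 R'` is the crude bond-`ℤ²` crossing probability (`M_1 = P_{1/2}`)
  have hP1 : ∀ R' : ConformalRectangle, P 1 R' = fun δ => (bondPercolation (zdGraph 2) half).real
      (embDomainCrossing squareLatticeEmbedding.z R'.carrier δ (R'.arc 0) (R'.arc 2)) := by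
    intro R'
    funext δ
    show cornerCrossingProb 1 R' δ = _
    rw [cornerCrossingProb_eq, cornerPercolation_one]
  exact hasCrossingLimit_of_quarterTurn_of_shearCardy
    (fun R δ => (bondPercolation (zdGraph 2) half).real
      (embDomainCrossing squareLatticeEmbedding.z R.carrier δ (R.arc 0) (R.arc 2)))
    (fun R L => by simp only [stub_bondCrude_quarterTurn])
    hα.ne'
    (fun R R' φ x hc hp hu => by
      have h := hCM R R' φ x hc hp hu
      rw [hP1 R'] at h
      exact h)

end Summit.CriticalPhenomena.CardyFormulaZ2.Theorems

end
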